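import Literature.Analysis.FunctionSpaces.BesovLittlewoodPaleyApproximation
import HarnessLib

/-!
# Lower semicontinuity of the Besov norm along continuous families; tails in `L^ℓ` of a parameter

Analysis/FunctionSpaces proof file (theorems only: no definition, no named fact). For a family of
tempered distributions `W : X → 𝓢'(E, F)` depending **continuously** on a parameter in a
first-countable space `X` (e.g. the time slices `t ↦ V(t)` of a weakly continuous blow-up limit):

* `lowerSemicontinuous_eHomBesovNorm_comp` — `x ↦ ‖W x‖_{Ḃ^s_{p,q}}` is lower semicontinuous
  (sequentially, by the Fatou property `eHomBesovNorm_le_liminf_of_tendsto` of `BesovFatou.lean`,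
  Bahouri–Chemin–Danchin 2011, Thm. 2.25; sequential and topological lower semicontinuity agree
  on first-countable spaces), hence measurable (`measurable_eHomBesovNorm_comp`);
* `tendsto_lintegral_rpow_eHomBesovNorm_sub_lowFreqCutoff` /
  `tendsto_lintegral_rpow_eHomBesovNorm_lowFreqCutoff` — **the Littlewood–Paley tails of a
  bounded continuous family tend to zero in `L^ℓ` of the parameter** (`0 < ℓ`, finite measure on
  `X`, `0 < q < ∞`, `sup_x ‖W x‖_{Ḃ^s_{p,q}} < ∞`):
  `∫ ‖W x - Ṡ_J (W x)‖^ℓ_{Ḃ^s_{p,q}} dμ(x) → 0` as `J → +∞` and `∫ ‖Ṡ_J (W x)‖^ℓ_{Ḃ^s_{p,q}} dμ(x) → 0`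
  as `J → -∞` (pointwise by `tendsto_eHomBesovNorm_sub_lowFreqCutoff_atTop` /
  `tendsto_eHomBesovNorm_lowFreqCutoff_atBot`, dominated by the uniform bounds
  `(1 + M₀) M`, `M₀ M`).

The second item is the time-integrated approximation "there exists a sequence `vⁿ ∈ C₀^∞` so that
`‖vⁿ - v‖_{L^ℓ(-T,0; Ḃ^{-1+3/p}_{p,q})} → 0`" of W. Wang, Z. Zhang, arXiv:1510.02589, §4 Step 1, with
the finite sums of Littlewood–Paley blocks `Ṡ_{J₂} - Ṡ_{J₁}` of the slices in place of `C₀^∞`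
functions (`BesovLittlewoodPaleyApproximation.lean`).

## References

* H. Bahouri, J.-Y. Chemin, R. Danchin, *Fourier Analysis and Nonlinear PDE* (2011), Thm. 2.25,
  Prop. 2.27. [BahouriCheminDanchin2011]
* W. Wang, Z. Zhang, Sci. China Math. 60 (2017) 637–650 = arXiv:1510.02589, §4 Step 1.
  [WangZhang2016]
-/

noncomputable section

open MeasureTheory TemperedDistribution Filter Set Function
open _root_.Topology
open scoped SchwartzMap ENNReal NNReal

namespace Literature.Analysis.FunctionSpaces

variable {E : Type*} [NormedAddCommGroup E] [InnerProductSpace ℝ E] [FiniteDimensional ℝ E]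
  [MeasurableSpace E] [BorelSpace E] {F : Type*} [NormedAddCommGroup F] [NormedSpace ℂ F]
  [CompleteSpace F] {X : Type*} [TopologicalSpace X] [FirstCountableTopology X]

/-! ## Lower semicontinuity and measurability -/

/-- **The Besov norm is lower semicontinuous along continuous families** (on a first-countable
parameter space): `x ↦ ‖W x‖_{Ḃ^s_{p,q}}` is lower semicontinuous for continuous
`W : X → 𝓢'(E, F)` (Fatou property, BCD Thm. 2.25, through sequences).
[cite: BahouriCheminDanchin2011, Thm. 2.25] -/
theorem lowerSemicontinuous_eHomBesovNorm_comp {W : X → 𝓢'(E, F)} (hW : Continuous W) (s : ℝ)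
    (p q : ℝ≥0∞) [Fact (1 ≤ p)] :
    LowerSemicontinuous fun x => eHomBesovNorm s p q (W x) := by
  intro x₀ y hy
  by_contra h
  have hfr : ∃ᶠ x in 𝓝 x₀, eHomBesovNorm s p q (W x) ≤ y := by
    simpa only [Filter.not_eventually, not_lt] using h
  obtain ⟨xs, hxs, hle⟩ := Filter.exists_seq_forall_of_frequently hfr
  have hconv : Tendsto (fun n => W (xs n)) atTop (𝓝 (W x₀)) := (hW.tendsto x₀).comp hxs
  have hlim := eHomBesovNorm_le_liminf_of_tendsto p hconv s q
  have hy' : liminf (fun n => eHomBesovNorm s p q (W (xs n))) atTop ≤ y :=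
    Filter.liminf_le_of_frequently_le (Frequently.of_forall hle)
  exact absurd (hy.trans_le (hlim.trans hy')) (lt_irrefl _)

/-- The Besov norm along a continuous family is measurable in the parameter.
[cite: BahouriCheminDanchin2011, Thm. 2.25] -/
theorem measurable_eHomBesovNorm_comp [MeasurableSpace X] [OpensMeasurableSpace X]
    {W : X → 𝓢'(E, F)} (hW : Continuous W) (s : ℝ) (p q : ℝ≥0∞) [Fact (1 ≤ p)] :
    Measurable fun x => eHomBesovNorm s p q (W x) :=
  (lowerSemicontinuous_eHomBesovNorm_comp hW s p q).measurable

/-! ## Littlewood–Paley tails of bounded continuous families vanish in `L^ℓ` of the parameter -/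

section Tails

variable [MeasurableSpace X] [OpensMeasurableSpace X] {μ : Measure X} [IsFiniteMeasure μ]

omit [TopologicalSpace X] [FirstCountableTopology X] [OpensMeasurableSpace X] in
/-- A constant finite bound is integrable against a finite measure (the dominating function).
[folklore] -/
theorem lintegral_const_ne_top_of_isFiniteMeasure {C : ℝ≥0∞} (hC : C ≠ ⊤) :
    ∫⁻ _x, C ∂μ ≠ ⊤ := by
  rw [lintegral_const]
  exact ENNReal.mul_ne_top hC (measure_ne_top μ _)

/-- **High-frequency tails vanish in `L^ℓ` of the parameter** (Wang–Zhang 2017, §4 Step 1, the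
`L^ℓ_t Ḃ` approximation; BCD Prop. 2.27 slice-wise plus dominated convergence): for continuous
`W : X → 𝓢'(E, F)` with `‖W x‖_{Ḃ^s_{p,q}} ≤ M < ∞` (`0 < q < ∞`), a finite measure `μ` on `X` and
`0 < ℓ`, `∫ ‖W x - Ṡ_J (W x)‖^ℓ_{Ḃ^s_{p,q}} dμ → 0` as `J → +∞`. [cite: WangZhang2016, §4 Step 1] -/
theorem tendsto_lintegral_rpow_eHomBesovNorm_sub_lowFreqCutoff {W : X → 𝓢'(E, F)}
    (hW : Continuous W) {s : ℝ} {p q : ℝ≥0∞} [Fact (1 ≤ p)] (hq₀ : q ≠ 0) (hq : q ≠ ⊤)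
    {M : ℝ≥0∞} (hM : M ≠ ⊤) (hbound : ∀ x, eHomBesovNorm s p q (W x) ≤ M) {ℓ : ℝ} (hℓ : 0 < ℓ) :
    Tendsto (fun J : ℤ => ∫⁻ x, eHomBesovNorm s p q (W x - lowFreqCutoff J (W x)) ^ ℓ ∂μ) atTop
      (𝓝 0) := by
  set C : ℝ≥0∞ := ((1 + lowFreqOpNormBound E) * M) ^ ℓ with hC
  have hCtop : C ≠ ⊤ := ENNReal.rpow_ne_top_of_nonneg hℓ.le
    (ENNReal.mul_ne_top (ENNReal.add_ne_top.2 ⟨ENNReal.one_ne_top, lowFreqOpNormBound_lt_top.ne⟩) hM)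
  -- measurability of the integrands: `x ↦ W x - Ṡ_J (W x)` is continuous
  have hmeas : ∀ J : ℤ, Measurable fun x => eHomBesovNorm s p q (W x - lowFreqCutoff J (W x)) ^ ℓ :=
    fun J => (measurable_eHomBesovNorm_comp (hW.sub ((lowFreqCutoff J).continuous.comp hW))
      s p q).pow_const ℓ
  have hle : ∀ J : ℤ, ∀ᵐ x ∂μ, eHomBesovNorm s p q (W x - lowFreqCutoff J (W x)) ^ ℓ ≤ C :=
    fun J => ae_of_all _ fun x => by
      rw [hC]
      exact ENNReal.rpow_le_rpow
        ((eHomBesovNorm_sub_lowFreqCutoff_le s p q J (W x)).trans (mul_le_mul_right (hbound x) _))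
        hℓ.le
  have hlim : ∀ᵐ x ∂μ, Tendsto (fun J : ℤ => eHomBesovNorm s p q (W x - lowFreqCutoff J (W x)) ^ ℓ)
      atTop (𝓝 0) := ae_of_all _ fun x => by
    have h0 := tendsto_eHomBesovNorm_sub_lowFreqCutoff_atTop hq₀ hq
      ((hbound x).trans_lt hM.lt_top) (s := s)
    have h1 := ((ENNReal.continuous_rpow_const (y := ℓ)).tendsto 0).comp h0
    rwa [ENNReal.zero_rpow_of_pos hℓ] at h1
  have key := tendsto_lintegral_filter_of_dominated_convergence (μ := μ) (l := (atTop : Filter ℤ))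
    (F := fun J x => eHomBesovNorm s p q (W x - lowFreqCutoff J (W x)) ^ ℓ) (f := fun _ => 0)
    (fun _ => C) (Eventually.of_forall hmeas) (Eventually.of_forall hle)
    (lintegral_const_ne_top_of_isFiniteMeasure hCtop) hlim
  simpa only [lintegral_zero] using key

/-- **Low-frequency tails vanish in `L^ℓ` of the parameter**: under the same hypotheses,
`∫ ‖Ṡ_J (W x)‖^ℓ_{Ḃ^s_{p,q}} dμ → 0` as `J → -∞`. [cite: WangZhang2016, §4 Step 1] -/
theorem tendsto_lintegral_rpow_eHomBesovNorm_lowFreqCutoff {W : X → 𝓢'(E, F)}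
    (hW : Continuous W) {s : ℝ} {p q : ℝ≥0∞} [Fact (1 ≤ p)] (hq₀ : q ≠ 0) (hq : q ≠ ⊤)
    {M : ℝ≥0∞} (hM : M ≠ ⊤) (hbound : ∀ x, eHomBesovNorm s p q (W x) ≤ M) {ℓ : ℝ} (hℓ : 0 < ℓ) :
    Tendsto (fun J : ℤ => ∫⁻ x, eHomBesovNorm s p q (lowFreqCutoff J (W x)) ^ ℓ ∂μ) atBot
      (𝓝 0) := by
  set C : ℝ≥0∞ := (lowFreqOpNormBound E * M) ^ ℓ with hC
  have hCtop : C ≠ ⊤ := ENNReal.rpow_ne_top_of_nonneg hℓ.le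
    (ENNReal.mul_ne_top lowFreqOpNormBound_lt_top.ne hM)
  have hmeas : ∀ J : ℤ, Measurable fun x => eHomBesovNorm s p q (lowFreqCutoff J (W x)) ^ ℓ :=
    fun J => (measurable_eHomBesovNorm_comp ((lowFreqCutoff J).continuous.comp hW) s p q).pow_const ℓ
  have hle : ∀ J : ℤ, ∀ᵐ x ∂μ, eHomBesovNorm s p q (lowFreqCutoff J (W x)) ^ ℓ ≤ C :=
    fun J => ae_of_all _ fun x => by
      rw [hC]
      exact ENNReal.rpow_le_rpow
        ((eHomBesovNorm_lowFreqCutoff_le' s p q J (W x)).trans (mul_le_mul_right (hbound x) _))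
        hℓ.le
  have hlim : ∀ᵐ x ∂μ, Tendsto (fun J : ℤ => eHomBesovNorm s p q (lowFreqCutoff J (W x)) ^ ℓ)
      atBot (𝓝 0) := ae_of_all _ fun x => by
    have h0 := tendsto_eHomBesovNorm_lowFreqCutoff_atBot hq₀ hq
      ((hbound x).trans_lt hM.lt_top) (s := s)
    have h1 := ((ENNReal.continuous_rpow_const (y := ℓ)).tendsto 0).comp h0
    rwa [ENNReal.zero_rpow_of_pos hℓ] at h1
  have key := tendsto_lintegral_filter_of_dominated_convergence (μ := μ) (l := (atBot : Filter ℤ))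
    (F := fun J x => eHomBesovNorm s p q (lowFreqCutoff J (W x)) ^ ℓ) (f := fun _ => 0)
    (fun _ => C) (Eventually.of_forall hmeas) (Eventually.of_forall hle)
    (lintegral_const_ne_top_of_isFiniteMeasure hCtop) hlim
  simpa only [lintegral_zero] using key

end Tails

end Literature.Analysis.FunctionSpaces

end
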